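import Mathlib
import Literature.Probability.LatticeModels.HighDimPointwiseTriviality
import Literature.Probability.LatticeModels.CriticalTwoPointLower

/-!
# Crux `CriticalTwoPointGSM`, line `Sketch` (canonical-lift spine): the diagonal joint mixed difference

Route `GaussianScaleMixture` of `Ising3DConformalLimit`, crux `CriticalTwoPointGSM`
(stmt-CriticalPhenomena-8365), line `Sketch`, canonical-lift spine (seat c1), stub
`diagMixedDifference_le` — a nine-direction DIVIDEND of the spine (not in the composition).

Write `G = criticalTwoPoint 3` for the critical two-point function `⟨σ₀ σ_x⟩⁺_{β_c}` of the
nearest-neighbour Ising model on `ℤ³` and `u = e₀ - e₁ = Pi.single 0 1 - Pi.single 1 1` for the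
face diagonal. GIVEN the diagonal Hausdorff representation (the statement of the sibling stub
`diagConsForm_hausdorff`, taken here as the hypothesis `hD`): for every finite `s` in the mirror
plane `{x 0 = x 1}` and every real `v`, the swap-mirror quadratic form
`N ↦ ∑_{x,y ∈ s} v_x v_y G(y - x + N • u)` is the moment sequence `∫ t^N dμ` of a finite measure
`μ` carried by `[0, 1]` — we prove the diagonal joint mixed difference at all heights and all
offsets on the mirror plane:

`G((N+1) • u) + G(z + N • u) ≤ G(N • u) + G(z + (N+1) • u)`   (`N ∈ ℕ`, `z 0 = z 1`),

i.e. `N ↦ G(N • u) - G(z + N • u)` is nonincreasing along the face diagonal (e.g.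
`G(2,-2,0) + G(1,-1,1) ≤ G(1,-1,0) + G(2,-2,1)`).

Proof: if `z = 0` both sides agree. Otherwise take `s = {0, z}`, `v = δ₀ - δ_z` in `hD`: the form
is `a(N) = 2 G(N • u) - G(z + N • u) - G(-z + N • u) = 2 G(N • u) - 2 G(z + N • u)`, by the
swap-mirror symmetry `G(-z + N • u) = G(z + N • u)` (evenness `G(-v) = G(v)` and invariance of `G`
under the coordinate swap `0 ↔ 1`, which fixes `z` and negates `u`). A `[0,1]`-moment sequence is
nonincreasing (`t^{N+1} ≤ t^N` on `[0,1]`), and `a(N+1) ≤ a(N)` is the claim.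

Contents: helpers in `CriticalTwoPointGSMJs.DiagMixedDifferenceLe` (moment monotonicity
`moment_succ_le`, the swap-mirror symmetry `swapMirror`, the two-point quadratic form
`pairForm_eq`, the case `z ≠ 0` `of_ne_zero`), then the registered stub `diagMixedDifference_le`.
-/

namespace Summit.CriticalPhenomena.Ising3DConformalLimit.Theorems

open MeasureTheory Filter Topology
open Literature.Probability.LatticeModels
open scoped BigOperators

noncomputable section

namespace CriticalTwoPointGSMJs.DiagMixedDifferenceLe

/-! ## Moment sequences of measures carried by `[0, 1]` are nonincreasing -/

/-- **Monotonicity of `[0,1]`-moments.** For a finite measure `μ` on `ℝ` carried by `[0, 1]` and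
every `n ∈ ℕ`: `∫ t^(n+1) dμ ≤ ∫ t^n dμ` (`t^(n+1) ≤ t^n` on `[0, 1]`; both powers are bounded by
`1` a.e., hence integrable). [folklore] -/
theorem moment_succ_le {μ : Measure ℝ} [IsFiniteMeasure μ] (hμ : μ (Set.Icc (0 : ℝ) 1)ᶜ = 0)
    (n : ℕ) : ∫ t, t ^ (n + 1) ∂μ ≤ ∫ t, t ^ n ∂μ := by
  have hae : ∀ᵐ t ∂μ, t ∈ Set.Icc (0 : ℝ) 1 := mem_ae_iff.2 hμ
  have hint : ∀ m : ℕ, Integrable (fun t : ℝ => t ^ m) μ := fun m =>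
    (integrable_const (1 : ℝ)).mono' (continuous_pow m).aestronglyMeasurable
      (hae.mono fun t ht => by
        rw [Real.norm_eq_abs, abs_of_nonneg (pow_nonneg ht.1 m)]
        exact pow_le_one₀ ht.1 ht.2)
  exact integral_mono_ae (hint (n + 1)) (hint n)
    (hae.mono fun t ht => pow_le_pow_of_le_one ht.1 ht.2 (Nat.le_succ n))

/-! ## The swap-mirror symmetry on the mirror plane -/

/-- **Swap-mirror symmetry.** For `z` on the mirror plane (`z 0 = z 1`) and `N ∈ ℕ`, with
`u = e₀ - e₁`: `G(-z + N • u) = G(z + N • u)`. Indeed `G(-z + N • u) = G(z - N • u)` by evenness of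
the two-point function, and `z - N • u = (z + N • u) ∘ swap₀₁` (the swap fixes `z` and negates
`u`), under which `G` is invariant (Friedli–Velenik 2017, Exercise 3.14). [folklore] -/
theorem swapMirror (N : ℕ) {z : Site 3} (hz0 : z 0 = z 1) :
    criticalTwoPoint 3 (-z + (N : ℤ) • (Pi.single 0 1 - Pi.single 1 1)) =
      criticalTwoPoint 3 (z + (N : ℤ) • (Pi.single 0 1 - Pi.single 1 1)) := by
  have h1 : (-z + (N : ℤ) • (Pi.single 0 1 - Pi.single 1 1) : Site 3) =
      -(fun i : Fin 3 =>
        (z + (N : ℤ) • (Pi.single 0 1 - Pi.single 1 1) : Site 3) (Equiv.swap (0 : Fin 3) 1 i)) := by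
    funext l
    fin_cases l <;> simp [hz0, Equiv.swap_apply_of_ne_of_ne] <;> ring
  rw [h1, criticalTwoPoint_neg]
  exact twoPointPlus_perm_invariant_holds (d := 3) (criticalBeta_nonneg 3) (Equiv.swap (0 : Fin 3) 1)
    (z + (N : ℤ) • (Pi.single 0 1 - Pi.single 1 1))

/-! ## The quadratic form of `δ₀ - δ_z` on `{0, z}` -/

/-- **The two-point quadratic form.** For `z ≠ 0` on the mirror plane and `v = δ₀ - δ_z` on
`s = {0, z}`, at every height `N ∈ ℕ`:
`∑_{x,y ∈ {0,z}} v_x v_y G(y - x + N • u) = 2 G(N • u) - 2 G(z + N • u)`, using the swap-mirror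
symmetry `G(-z + N • u) = G(z + N • u)`. [folklore] -/
theorem pairForm_eq (N : ℕ) {z : Site 3} (hz0 : z 0 = z 1) (hz : z ≠ 0) :
    ∑ x ∈ ({0, z} : Finset (Site 3)), ∑ y ∈ ({0, z} : Finset (Site 3)),
      ((if x = 0 then (1 : ℝ) else 0) - (if x = z then 1 else 0)) *
        ((if y = 0 then (1 : ℝ) else 0) - (if y = z then 1 else 0)) *
          criticalTwoPoint 3 (y - x + (N : ℤ) • (Pi.single 0 1 - Pi.single 1 1)) =
      2 * criticalTwoPoint 3 ((N : ℤ) • (Pi.single 0 1 - Pi.single 1 1)) -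
        2 * criticalTwoPoint 3 (z + (N : ℤ) • (Pi.single 0 1 - Pi.single 1 1)) := by
  rw [Finset.sum_pair hz.symm, Finset.sum_pair hz.symm, Finset.sum_pair hz.symm]
  simp only [if_true, if_neg hz, if_neg hz.symm, sub_zero, zero_sub, sub_self, zero_add,
    swapMirror N hz0]
  ring

/-! ## The case `z ≠ 0` -/

/-- **The diagonal joint mixed difference, `z ≠ 0`.** Given the diagonal Hausdorff representation
`hD`, for `N ∈ ℕ` and `z ≠ 0` on the mirror plane:
`G((N+1) • u) + G(z + N • u) ≤ G(N • u) + G(z + (N+1) • u)` (`s = {0, z}`, `v = δ₀ - δ_z`: the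
moment sequence `a(N) = 2 G(N • u) - 2 G(z + N • u)` is nonincreasing). [folklore] -/
theorem of_ne_zero
    (hD : ∀ (s : Finset (Site 3)), (∀ x ∈ s, x 0 = x 1) → ∀ (v : Site 3 → ℝ),
      ∃ μ : Measure ℝ, IsFiniteMeasure μ ∧ μ (Set.Icc (0 : ℝ) 1)ᶜ = 0 ∧
        ∀ N : ℕ, ∑ x ∈ s, ∑ y ∈ s, v x * v y *
          criticalTwoPoint 3 (y - x + (N : ℤ) • (Pi.single 0 1 - Pi.single 1 1)) = ∫ t, t ^ N ∂μ)
    (N : ℕ) {z : Site 3} (hz0 : z 0 = z 1) (hz : z ≠ 0) :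
    criticalTwoPoint 3 (((N + 1 : ℕ) : ℤ) • (Pi.single 0 1 - Pi.single 1 1)) +
        criticalTwoPoint 3 (z + (N : ℤ) • (Pi.single 0 1 - Pi.single 1 1)) ≤
      criticalTwoPoint 3 ((N : ℤ) • (Pi.single 0 1 - Pi.single 1 1)) +
        criticalTwoPoint 3 (z + ((N + 1 : ℕ) : ℤ) • (Pi.single 0 1 - Pi.single 1 1)) := by
  have hs : ∀ x ∈ ({0, z} : Finset (Site 3)), x 0 = x 1 := by
    intro x hx
    rcases Finset.mem_insert.1 hx with rfl | hx
    · rfl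
    · rw [Finset.mem_singleton.1 hx]
      exact hz0
  obtain ⟨μ, hfin, hsupp, hmom⟩ :=
    hD {0, z} hs (fun x => (if x = 0 then (1 : ℝ) else 0) - (if x = z then 1 else 0))
  have h0 : 2 * criticalTwoPoint 3 ((N : ℤ) • (Pi.single 0 1 - Pi.single 1 1)) -
      2 * criticalTwoPoint 3 (z + (N : ℤ) • (Pi.single 0 1 - Pi.single 1 1)) = ∫ t, t ^ N ∂μ := by
    rw [← pairForm_eq N hz0 hz]
    exact hmom N
  have h1 : 2 * criticalTwoPoint 3 (((N + 1 : ℕ) : ℤ) • (Pi.single 0 1 - Pi.single 1 1)) -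
      2 * criticalTwoPoint 3 (z + ((N + 1 : ℕ) : ℤ) • (Pi.single 0 1 - Pi.single 1 1)) =
        ∫ t, t ^ (N + 1) ∂μ := by
    rw [← pairForm_eq (N + 1) hz0 hz]
    exact hmom (N + 1)
  have hle : ∫ t, t ^ (N + 1) ∂μ ≤ ∫ t, t ^ N ∂μ := moment_succ_le hsupp N
  linarith

end CriticalTwoPointGSMJs.DiagMixedDifferenceLe

/-- **STUB `diagMixedDifference_le` (the diagonal joint mixed difference, all heights and all
offsets on the mirror plane).** Given the diagonal Hausdorff representation `hD` (the swap-mirror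
quadratic forms of `G = ⟨σ₀σ_·⟩⁺_{β_c}` on the mirror plane `{x 0 = x 1}` are `[0,1]`-moment
sequences along the face diagonal `u = e₀ - e₁`): for every `N ∈ ℕ` and every `z ∈ ℤ³` with
`z 0 = z 1`, `G((N+1) • u) + G(z + N • u) ≤ G(N • u) + G(z + (N+1) • u)` — i.e.
`N ↦ G(N • u) - G(z + N • u)` is nonincreasing; at `N = 1`, `z = e₂`:
`G(2,-2,0) + G(1,-1,1) ≤ G(1,-1,0) + G(2,-2,1)`. [folklore] -/
theorem diagMixedDifference_le
    (hD : ∀ (s : Finset (Site 3)), (∀ x ∈ s, x 0 = x 1) → ∀ (v : Site 3 → ℝ),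
      ∃ μ : Measure ℝ, IsFiniteMeasure μ ∧ μ (Set.Icc (0 : ℝ) 1)ᶜ = 0 ∧
        ∀ N : ℕ, ∑ x ∈ s, ∑ y ∈ s, v x * v y *
          criticalTwoPoint 3 (y - x + (N : ℤ) • (Pi.single 0 1 - Pi.single 1 1)) = ∫ t, t ^ N ∂μ) :
    ∀ (N : ℕ) (z : Site 3), z 0 = z 1 →
      criticalTwoPoint 3 (((N + 1 : ℕ) : ℤ) • (Pi.single 0 1 - Pi.single 1 1)) +
          criticalTwoPoint 3 (z + (N : ℤ) • (Pi.single 0 1 - Pi.single 1 1)) ≤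
        criticalTwoPoint 3 ((N : ℤ) • (Pi.single 0 1 - Pi.single 1 1)) +
          criticalTwoPoint 3 (z + ((N + 1 : ℕ) : ℤ) • (Pi.single 0 1 - Pi.single 1 1)) := by
  intro N z hz0
  by_cases hz : z = 0
  · subst hz
    rw [zero_add, zero_add]
    exact (add_comm _ _).le
  · exact CriticalTwoPointGSMJs.DiagMixedDifferenceLe.of_ne_zero hD N hz0 hz

end

end Summit.CriticalPhenomena.Ising3DConformalLimit.Theorems
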